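import Mathlib
import HarnessLib

/-!
# The interior strain of an elliptic (Kirchhoff) uniform-vorticity core: `e/ω₀ = (a − b)/(2(a + b))`,
# equal to the Gaussian one-tube cap `3/20` exactly at aspect ratio `a/b = 13/7`
# (instab lane, door O-acc = O7, obstruction P3 — refuter2's «third cause» number of `HEREDITY-P3.md` v1.4 (B))

HONEST FRAMING (cell `ns-blowup`, seat `ns-blowup-instab2`; human ruling D-0035): nothing here is a
claim about Navier–Stokes blow-up. WHAT THIS IS NOT: not dynamics, and NOT a proof that the Kirchhoff
ellipse is an Euler solution: the classical fact that the velocity INSIDE a uniformly rotating elliptic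
patch `x²/a² + y²/b² ≤ 1` of vorticity `ω₀` is the LINEAR field
`u(x, y) = (ω₀/(a + b)) · (−a·y, b·x)` [Lamb, Hydrodynamics §159; Saffman, Vortex Dynamics (1992) §9.3]
enters only as the explicit form of the field whose gradient we evaluate. The file is the two-line algebra
the cell's census sentence uses (STATUS 2026-08-25, refuter2 g3 K-READ «θ-ENVELOPE» (4), instab2 g4 l.1309):

* `kirchhoff_vorticity`: `∂ₓu₂ − ∂_y u₁ = ω₀` (the patch's vorticity, consistency check);
* incompressibility `∂ₓu₁ + ∂_y u₂ = 0 + 0` is immediate from `hasDerivAt_u1_dx` / `hasDerivAt_u2_dy`;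
* `kirchhoff_strain_offdiag`: the rate-of-strain tensor is `[[0, e], [e, 0]]` with
  `e = ½(∂_y u₁ + ∂ₓ u₂) = −ω₀ (a − b) / (2(a + b))` — principal strains `±|e|` on the diagonals;
* `kirchhoff_strain_ratio_abs`: `|e| / |ω₀| = |a − b| / (2(a + b))` for `a, b > 0`, `ω₀ ≠ 0`;
* `kirchhoff_ratio_lt_half`: `|a − b|/(2(a+b)) < ½` always (an elliptic core never strains faster than half
  its own vorticity); `kirchhoff_ratio_circular`: `= 0` iff `a = b` (solid-body rotation);
* `kirchhoff_ratio_eq_cap_iff`: for `a ≥ b > 0`, `(a − b)/(2(a + b)) = 3/20 ↔ 7a = 13b` — the interior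
  strain of an elliptic core equals the sharp Gaussian one-tube cap `3/20`
  (`BurgersTubeStrainSharp.oseenStrain_le_sharp`) EXACTLY at aspect ratio `13/7 ≈ 1.857`, and exceeds it
  iff `7a > 13b` (`kirchhoff_ratio_gt_cap_iff`); numbers of record: `0.045 / 0.100 / 0.167 / 0.250` at
  `a/b = 1.2 / 1.5 / 2 / 3` (`kirchhoff_ratio_values`).

Stage-1 caveat (kernel `ABCDiagonalC3Symmetry`, p409995): on-axis sections of an A₄-symmetric rope have
isotropic second moments, so this m = 2 signature is available only for OFF-AXIS cores (burst debris) or a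
symmetry-free stage 2. Mathlib only. No definitions. LABEL: MODEL-door bookkeeping.
-/

namespace Summit.NavierStokesRegularity.FluidComputer.KirchhoffCoreStrain

variable {a b ω₀ : ℝ} {u₁ u₂ : ℝ → ℝ → ℝ}

/-- `∂ₓ u₁ = 0` for `u₁(x,y) = −(ω₀/(a+b))·a·y`. -/
theorem hasDerivAt_u1_dx (hu₁ : ∀ x y, u₁ x y = -(ω₀ / (a + b)) * a * y) (x y : ℝ) :
    HasDerivAt (fun x => u₁ x y) 0 x := by
  have h : (fun x => u₁ x y) = fun _ => -(ω₀ / (a + b)) * a * y := by funext x; rw [hu₁]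
  rw [h]; exact hasDerivAt_const x _

/-- `∂_y u₁ = −(ω₀/(a+b))·a`. -/
theorem hasDerivAt_u1_dy (hu₁ : ∀ x y, u₁ x y = -(ω₀ / (a + b)) * a * y) (x y : ℝ) :
    HasDerivAt (fun y => u₁ x y) (-(ω₀ / (a + b)) * a) y := by
  have h : (fun y => u₁ x y) = fun y => -(ω₀ / (a + b)) * a * y := by funext y; rw [hu₁]
  rw [h]; simpa using (hasDerivAt_id' y).const_mul (-(ω₀ / (a + b)) * a)

/-- `∂ₓ u₂ = (ω₀/(a+b))·b` for `u₂(x,y) = (ω₀/(a+b))·b·x`. -/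
theorem hasDerivAt_u2_dx (hu₂ : ∀ x y, u₂ x y = ω₀ / (a + b) * b * x) (x y : ℝ) :
    HasDerivAt (fun x => u₂ x y) (ω₀ / (a + b) * b) x := by
  have h : (fun x => u₂ x y) = fun x => ω₀ / (a + b) * b * x := by funext x; rw [hu₂]
  rw [h]; simpa using (hasDerivAt_id' x).const_mul (ω₀ / (a + b) * b)

/-- `∂_y u₂ = 0`. -/
theorem hasDerivAt_u2_dy (hu₂ : ∀ x y, u₂ x y = ω₀ / (a + b) * b * x) (x y : ℝ) :
    HasDerivAt (fun y => u₂ x y) 0 y := by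
  have h : (fun y => u₂ x y) = fun _ => ω₀ / (a + b) * b * x := by funext y; rw [hu₂]
  rw [h]; exact hasDerivAt_const y _

/-- VORTICITY: `∂ₓu₂ − ∂_y u₁ = ω₀` (for `a + b ≠ 0`). -/
theorem kirchhoff_vorticity (hab : a + b ≠ 0) :
    ω₀ / (a + b) * b - (-(ω₀ / (a + b)) * a) = ω₀ := by
  field_simp
  ring

/-- THE INTERIOR STRAIN: `e := ½(∂_y u₁ + ∂ₓ u₂) = −ω₀ (a − b)/(2(a + b))` (for `a + b ≠ 0`); the
rate-of-strain tensor is `[[0, e], [e, 0]]`, principal strains `±|e|` along the diagonals `y = ±x`. -/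
theorem kirchhoff_strain_offdiag (hab : a + b ≠ 0) :
    (1/2 : ℝ) * (-(ω₀ / (a + b)) * a + ω₀ / (a + b) * b) = -(ω₀ * (a - b) / (2 * (a + b))) := by
  field_simp
  ring

/-- `|e| / |ω₀| = |a − b| / (2(a + b))` for `a, b > 0`, `ω₀ ≠ 0`: the Kirchhoff strain-to-vorticity ratio. -/
theorem kirchhoff_strain_ratio_abs (ha : 0 < a) (hb : 0 < b) (hω : ω₀ ≠ 0) :
    |-(ω₀ * (a - b) / (2 * (a + b)))| / |ω₀| = |a - b| / (2 * (a + b)) := by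
  have hab : 0 < a + b := by linarith
  rw [abs_neg, abs_div, abs_mul, abs_of_pos (by linarith : (0:ℝ) < 2 * (a + b))]
  field_simp

/-- An elliptic core never strains faster than HALF its own vorticity: `|a − b|/(2(a + b)) < ½`. -/
theorem kirchhoff_ratio_lt_half (ha : 0 < a) (hb : 0 < b) : |a - b| / (2 * (a + b)) < 1 / 2 := by
  have hab : 0 < 2 * (a + b) := by linarith
  rw [div_lt_iff₀ hab, abs_lt]
  constructor <;> linarith

/-- The ratio vanishes iff the core is circular (`a = b`: solid-body rotation, no strain). -/
theorem kirchhoff_ratio_circular (ha : 0 < a) (hb : 0 < b) : |a - b| / (2 * (a + b)) = 0 ↔ a = b := by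
  have hab : (2 * (a + b)) ≠ 0 := by linarith
  rw [div_eq_zero_iff, abs_eq_zero, sub_eq_zero]
  exact ⟨fun h => h.resolve_right hab, fun h => Or.inl h⟩

/-- THE CROSSING: for `a ≥ b > 0`, `(a − b)/(2(a + b)) = 3/20 ↔ 7a = 13b` — the interior strain equals the
sharp Gaussian one-tube cap `3/20` exactly at aspect ratio `a/b = 13/7`. -/
theorem kirchhoff_ratio_eq_cap_iff (ha : 0 < a) (hb : 0 < b) :
    (a - b) / (2 * (a + b)) = 3 / 20 ↔ 7 * a = 13 * b := by
  have hab : (2 * (a + b)) ≠ 0 := by linarith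
  rw [div_eq_iff hab]
  constructor <;> intro h <;> linarith

/-- … and exceeds the cap iff `7a > 13b` (aspect ratio above `13/7 ≈ 1.857`). -/
theorem kirchhoff_ratio_gt_cap_iff (ha : 0 < a) (hb : 0 < b) :
    3 / 20 < (a - b) / (2 * (a + b)) ↔ 13 * b < 7 * a := by
  have hab : 0 < 2 * (a + b) := by linarith
  rw [lt_div_iff₀ hab]
  constructor <;> intro h <;> linarith

/-- Numbers of record (refuter2 K-READ): `e/ω₀ = 1/22, 1/10, 1/6, 1/4` at `a/b = 6/5, 3/2, 2, 3`
(i.e. `0.045 / 0.100 / 0.167 / 0.250`). -/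
theorem kirchhoff_ratio_values :
    ((6:ℝ) - 5) / (2 * (6 + 5)) = 1 / 22 ∧ ((3:ℝ) - 2) / (2 * (3 + 2)) = 1 / 10 ∧
      ((2:ℝ) - 1) / (2 * (2 + 1)) = 1 / 6 ∧ ((3:ℝ) - 1) / (2 * (3 + 1)) = 1 / 4 := by
  norm_num

end Summit.NavierStokesRegularity.FluidComputer.KirchhoffCoreStrain
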